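import Summits.ABC.IUTFork.LDHSlotResidueSplitWitness
import Mathlib.NumberTheory.NumberField.Cyclotomic.Ideal
import HarnessLib

/-!
# The split-prime witness is INHABITED: `ℚ(ζ₃)` has two places over `7`, so NO depth-uniform computable half in
# reading (U) exists — absolute form of `LDHSlotResidueSplitWitness` (VERDICT RISK ¶7, crux `ThetaPartII` (U)-line)

Record-only PROOF file (D-0012) of the abc-iut cell (campaign-S seat abc-iut-S7, gen 4; sequel to
`LDHSlotResidueSplitWitness.lean`); TAKES NO SIDE on [IUTchIII] Cor. 3.12 or [IUTchIV] Thm. 1.10.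

`LDHSlotResidueSplitWitness.exists_deepSplitAt_not_hullEstimateOf` proves, for number fields `F₀ ⊆ K`, a section `σ`,
a prime `p` under two DISTINCT places `v₀ ≠ w` of `F₀` and a prime `l ≥ 5`: for every real `δ` some depth `N` makes the
synthetic genuine-typed Θ-volume input `deepSplitAt p l N σ v₀` violate `HullEstimateOf δ` (S. Mochizuki, *IUT IV*
[Mochizuki2012] Thm. 1.10 Step (v) pp. 27–28 read in (U): the hull of the union over the (Ind1)-slot permutations;
Dupuy–Hilado [DupuyHilado2025] §4.7, §4.10–4.12). This file discharges the hypothesis «two distinct places over `p`»: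

* `exists_two_placesOver_cyclotomicField_three` — in `ℚ(ζ₃)` the prime `7` lies under two distinct places
  (Mathlib's splitting law for cyclotomic fields, `IsCyclotomicExtension.Rat.ramificationIdxIn_eq_of_not_dvd` /
  `inertiaDegIn_eq_of_not_dvd`: `7 ∤ 3`, `7 ≡ 1 (mod 3)` so `e = f = 1`, and the fundamental identity for the Galois
  extension `ℚ(ζ₃)/ℚ` of degree `φ(3) = 2` gives `#{𝔭 | 7} = 2`). Classical, PROVED.
* **`exists_numberField_noDepthUniformHull`** — the ABSOLUTE form: for every prime `l ≥ 5` there exist a number field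
  (`F₀ = K = ℚ(ζ₃)`, any section of its own places), a prime (`p = 7`) and a place `v₀ | p` such that NO real `C`
  satisfies `(deepSplitAt p l N σ v₀).HullEstimateOf C` for every depth `N`.
* `exists_numberField_depthUniform_dichotomy` — the same field carries BOTH families of the dichotomy
  (`hullEstimateOf_depthUniform_dichotomy`): the slot-constant `deepAt 7 l N σ` with one depth-free constant for all `N`,
  and the split `deepSplitAt 7 l N σ v₀` with none.

HONEST SCOPE: statements about SYNTHETIC inhabitants of the input type over a concrete number field; no Θ-datum of an
elliptic curve is constructed; nothing asserts or denies [IUTchIV] Thm. 1.10 / [IUTchIII] Cor. 3.12 for initial Θ-data;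
typed ≠ proved; no side taken. PROOF-ONLY file: no definitions, no `Prop` facts.
[cite: Mochizuki2012, IUTchIV Thm. 1.10 Step (v) p. 27–28] [cite: DupuyHilado2025, §4.7, §4.10–4.12]
[cite: NeukirchANT1999, Ch. I §8, §10] [claim: Mochizuki2012, status: disputed] for every IUT quotation.
-/

noncomputable section

open NumberField IsDedekindDomain Literature.IUT.LogVolume Ideal

namespace Summit.ABC.IUTFork

/-- **In `ℚ(ζ₃)` the prime `7` lies under two DISTINCT places** (`7 ∤ 3` and `7 ≡ 1 (mod 3)`: unramified with residue
degree `orderOf (7 : ZMod 3) = 1`, so the fundamental identity `#{𝔭 | 7}·e·f = [ℚ(ζ₃):ℚ] = φ(3) = 2` for the Galois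
extension `ℚ(ζ₃)/ℚ` gives two primes). Classical (Mathlib's cyclotomic splitting law), PROVED — the non-vacuity of
the hypothesis «two distinct places `v₀ ≠ w` of `F₀` over `p`» of the split-prime witness.
[cite: NeukirchANT1999, Ch. I §8, §10] -/
theorem exists_two_placesOver_cyclotomicField_three :
    ∃ v₀ w : placesOver (CyclotomicField 3 ℚ) 7, w ≠ v₀ := by
  haveI : Fact (Nat.Prime 7) := ⟨by decide⟩
  set K := CyclotomicField 3 ℚ with hKdef
  haveI hK : IsCyclotomicExtension {3} ℚ K := CyclotomicField.isCyclotomicExtension 3 ℚ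
  haveI : IsGalois ℚ K := IsCyclotomicExtension.isGalois {3} ℚ K
  have h73 : ¬ (7 ∣ 3) := by decide
  have hmain := Ideal.ncard_primesOver_mul_ramificationIdxIn_mul_inertiaDegIn
    (span {((7 : ℕ) : ℤ)}) (𝓞 K) Gal(K/ℚ)
  rw [IsCyclotomicExtension.Rat.ramificationIdxIn_eq_of_not_dvd 7 K h73,
    IsCyclotomicExtension.Rat.inertiaDegIn_eq_of_not_dvd 7 K h73,
    IsGaloisGroup.card_eq_finrank Gal(K/ℚ) ℚ K, IsCyclotomicExtension.Rat.finrank 3 K] at hmain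
  have h1 : orderOf ((7 : ℕ) : ZMod 3) = 1 := by
    rw [show ((7 : ℕ) : ZMod 3) = 1 from by decide, orderOf_one]
  rw [h1, show Nat.totient 3 = 2 from by decide] at hmain
  have hcard : (primesOver (span {((7 : ℕ) : ℤ)}) (𝓞 K)).ncard = 2 := by simpa using hmain
  obtain ⟨P, Q, hPQ, hset⟩ := Set.ncard_eq_two.mp hcard
  have hP : P ∈ primesOver (span {((7 : ℕ) : ℤ)}) (𝓞 K) := by rw [hset]; exact Set.mem_insert _ _
  have hQ : Q ∈ primesOver (span {((7 : ℕ) : ℤ)}) (𝓞 K) := by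
    rw [hset]; exact Set.mem_insert_of_mem _ rfl
  have hpb : span {((7 : ℕ) : ℤ)} ≠ ⊥ := by simp
  let vP : HeightOneSpectrum (𝓞 K) := ⟨P, hP.1, Ideal.ne_bot_of_mem_primesOver hpb hP⟩
  let vQ : HeightOneSpectrum (𝓞 K) := ⟨Q, hQ.1, Ideal.ne_bot_of_mem_primesOver hpb hQ⟩
  have hvP : vP ∈ placesOver K 7 := (mem_placesOver_iff vP).mpr hP.2
  have hvQ : vQ ∈ placesOver K 7 := (mem_placesOver_iff vQ).mpr hQ.2
  refine ⟨⟨vP, hvP⟩, ⟨vQ, hvQ⟩, fun h => hPQ ?_⟩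
  have := congrArg (fun v : placesOver K 7 => v.1.asIdeal) h
  exact this.symm

/-- **THE SPLIT-PRIME WITNESS IS INHABITED (absolute form, no hypothesis).** For every prime `l ≥ 5` there are a number
field `F₀` (namely `ℚ(ζ₃)`, with `K := F₀` and a section of its own places), a prime `p` (namely `7`) and a place
`v₀ | p` of `F₀` such that NO real constant `C` satisfies `(deepSplitAt p l N σ v₀).HullEstimateOf C` for every depth
`N`: in reading (U) ((Ind1) = all slot permutations) the computable half of [IUTchIV] Thm. 1.10 is NOT a depth-uniform
statement on the type of Θ-volume inputs. About SYNTHETIC inputs; nothing asserted about initial Θ-data of an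
elliptic curve; no side taken. [cite: Mochizuki2012, IUTchIV Thm. 1.10 Step (v) p. 27–28]
[cite: DupuyHilado2025, §4.7, §4.10–4.12] [claim: Mochizuki2012, status: disputed] -/
theorem exists_numberField_noDepthUniformHull (l : ℕ) (hl : l.Prime) (h5 : 5 ≤ l) :
    ∃ (F₀ : Type) (_ : Field F₀) (_ : NumberField F₀) (p : ℕ) (hp : Fact p.Prime)
      (σ : PlaceSection F₀ F₀) (v₀ : placesOver F₀ p),
      ∀ C : ℝ, ∃ (N : ℕ) (hN : 0 < N),
        ¬ (ThetaVolumeInput.deepSplitAt (hp := hp) p l hl h5 N hN σ v₀).HullEstimateOf C := by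
  haveI h7 : Fact (Nat.Prime 7) := ⟨by decide⟩
  obtain ⟨v₀, w, hw⟩ := exists_two_placesOver_cyclotomicField_three
  obtain ⟨σ⟩ := PlaceSection.nonempty (F₀ := CyclotomicField 3 ℚ) (K := CyclotomicField 3 ℚ)
  exact ⟨CyclotomicField 3 ℚ, inferInstance, inferInstance, 7, h7, σ, v₀, fun C =>
    ThetaVolumeInput.exists_deepSplitAt_not_hullEstimateOf 7 l hl h5 σ v₀ w hw C⟩

/-- **THE DICHOTOMY IS INHABITED over one concrete field.** For every prime `l ≥ 5`: over `F₀ = K = ℚ(ζ₃)` with the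
prime `7` (two places `v₀ ≠ w`) and a section `σ` of its own places, (a) ONE real `C` serves every depth of the
slot-constant family `deepAt 7 l N σ`, (b) NO real serves every depth of the split family `deepSplitAt 7 l N σ v₀`
(`hullEstimateOf_depthUniform_dichotomy` instantiated). Nothing asserted about Θ-data of elliptic curves; no side taken.
[cite: Mochizuki2012, IUTchIV Thm. 1.10 Step (v) p. 27–28] [cite: DupuyHilado2025, §4.7, §4.10–4.12]
[claim: Mochizuki2012, status: disputed] -/
theorem exists_numberField_depthUniform_dichotomy (l : ℕ) (hl : l.Prime) (h5 : 5 ≤ l) :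
    ∃ (F₀ : Type) (_ : Field F₀) (_ : NumberField F₀) (p : ℕ) (hp : Fact p.Prime)
      (σ : PlaceSection F₀ F₀) (v₀ : placesOver F₀ p),
      (∃ C : ℝ, ∀ (N : ℕ) (hN : 0 < N), (ThetaVolumeInput.deepAt (hp := hp) p l hl h5 N hN σ).HullEstimateOf C) ∧
        (∀ C : ℝ, ∃ (N : ℕ) (hN : 0 < N),
          ¬ (ThetaVolumeInput.deepSplitAt (hp := hp) p l hl h5 N hN σ v₀).HullEstimateOf C) := by
  haveI h7 : Fact (Nat.Prime 7) := ⟨by decide⟩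
  obtain ⟨v₀, w, hw⟩ := exists_two_placesOver_cyclotomicField_three
  obtain ⟨σ⟩ := PlaceSection.nonempty (F₀ := CyclotomicField 3 ℚ) (K := CyclotomicField 3 ℚ)
  exact ⟨CyclotomicField 3 ℚ, inferInstance, inferInstance, 7, h7, σ, v₀,
    ThetaVolumeInput.hullEstimateOf_depthUniform_dichotomy 7 l hl h5 σ v₀ w hw⟩

end Summit.ABC.IUTFork

end
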